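import Literature.MathematicalPhysics.QuantumLattice.HeisenbergRPSiteMonotonicity
import HarnessLib

/-!
# Reflection-positivity monotonicity of shifted Gram forms (palindromic site families)

[LeesTaggi2021, Thm 4, Lemma 7] prove the site-monotonicity of the two-point function of the
reflection-positive quantum Heisenberg antiferromagnet from two ingredients: the Schwarz inequality of
reflection positivity (midpoint convexity under even shifts) and the torus reflection symmetry. The tree
file `HeisenbergRPSiteMonotonicity` records the one-site family (`heisRedCorr2_oddAxis_antitone`).
Both ingredients apply verbatim to an arbitrary finitely supported weighted family of sites
([LeesTaggi2021, Lemma 7] is stated for arbitrary finitely supported functions), provided the family is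
PALINDROMIC in the row direction (closed under `i ↦ m - 1 - i` with the weights preserved up to a common
sign), which is what makes the torus reflection `a ↦ 2k - a` act on the shifted Gram forms of ONE family.
This file records that general form: for sites `s p = (i_p, t_p)` with rows `i_p ≤ m - 1`, weights `c_p`,
and the shifted Gram form
`Q(j) := Σ_{p,q} c_p c_q (−c(i_p + i_q + 2j + 1, |t_p − t_q|))`,
one has `0 ≤ Q(j)`, `2 Q(j+1) ≤ Q(j) + Q(j+2)`, `Q(k - m - j) = Q(j)` for palindromic families, hence
`Q(j+1) ≤ Q(j)` for `m + 2j + 1 ≤ k`.  In the spectral reading of the reflection-positivity Hankel data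
(`−c(a, ·) ↔ ∫ λ^{a-1} dμ`) these are the rows `∫ λ^{2j} (1 − λ²) |ĉ(λ, θ)|² dμ ≥ 0`, i.e. the linear
constraints that confine truncated reflection-positivity moment data to `λ ∈ [−1, 1]`.

References: [cite: LeesTaggi2021, Thm 4, Lemma 7] (B. Lees, L. Taggi, *Site-monotonicity
properties for reflection positive measures with applications to quantum spin systems*,
J. Stat. Phys. **183** (2021) 38, arXiv:2002.12666); [cite: DLS1978, Theorem 4.2]; [cite: KLS1988JSP, eq. (25)].
-/

noncomputable section

namespace Literature.MathematicalPhysics.QuantumLattice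

open Finset Literature.Probability.LatticeModels

/-- The reflection-positivity Gram form of the weighted site family `(s, c)` shifted by `j` rows away
from the reflection plane: `Q(j) = Σ_{p,q} c_p c_q (−c(i_p + i_q + 2j + 1, |t_p − t_q|))`.
[cite: LeesTaggi2021, Lemma 7] -/
def heisRPShiftForm (k n : ℕ) {r : ℕ} (s : Fin r → ℕ × ℕ) (c : Fin r → ℝ) (j : ℕ) : ℝ :=
  ∑ p, ∑ q, c p * c q *
    -heisRedCorr2 (2 * k) n ((s p).1 + (s q).1 + 2 * j + 1) (Int.natAbs (((s p).2 : ℤ) - (s q).2))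

/-- **Non-negativity of the shifted Gram form**: `0 ≤ Q(j)` whenever all shifted rows `i_p + j < k`.
[cite: LeesTaggi2021, Lemma 7] [cite: DLS1978, Theorem 4.2] -/
theorem heisRPShiftForm_nonneg (k n : ℕ) [NeZero (2 * k)] {r : ℕ} (s : Fin r → ℕ × ℕ) (c : Fin r → ℝ)
    (j : ℕ) (hs : ∀ p, (s p).1 + j < k) : 0 ≤ heisRPShiftForm k n s c j := by
  have h := heis_rpGram_sites k n (fun p => ((s p).1 + j, (s p).2)) (fun p => hs p) c
  refine h.trans_eq (sum_congr rfl fun p _ => sum_congr rfl fun q _ => ?_)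
  have e : (s p).1 + j + ((s q).1 + j) + 1 = (s p).1 + (s q).1 + 2 * j + 1 := by ring
  simp only [e]

/-- **Midpoint convexity under even shifts**: `2 Q(j+1) ≤ Q(j) + Q(j+2)` whenever `i_p + j + 2 < k`
— the Gram form of the doubled family `(s + j, c) ∪ (s + j + 2, −c)`.
[cite: LeesTaggi2021, Thm 4 (proof), Lemma 7] [cite: KLS1988JSP, eq. (25)] -/
theorem heisRPShiftForm_midpointConvex (k n : ℕ) [NeZero (2 * k)] {r : ℕ} (s : Fin r → ℕ × ℕ)
    (c : Fin r → ℝ) (j : ℕ) (hs : ∀ p, (s p).1 + j + 2 < k) :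
    2 * heisRPShiftForm k n s c (j + 1) ≤ heisRPShiftForm k n s c j + heisRPShiftForm k n s c (j + 2) := by
  set s' : Fin (r + r) → ℕ × ℕ :=
    Fin.append (fun p => ((s p).1 + j, (s p).2)) (fun p => ((s p).1 + j + 2, (s p).2)) with hs'
  set c' : Fin (r + r) → ℝ := Fin.append c (fun p => -c p) with hc'
  have hsk : ∀ x, (s' x).1 < k := by
    intro x
    refine Fin.addCases (motive := fun x => (s' x).1 < k) (fun p => ?_) (fun p => ?_) x
    · simp only [hs', Fin.append_left]; have := hs p; omega
    · simp only [hs', Fin.append_right]; have := hs p; omega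
  have h := heis_rpGram_sites k n s' hsk c'
  simp only [Fin.sum_univ_add, hs', hc', Fin.append_left, Fin.append_right] at h
  have e11 : ∀ p q : Fin r, (s p).1 + j + ((s q).1 + j) + 1 = (s p).1 + (s q).1 + 2 * j + 1 := by
    intro p q; ring
  have e12 : ∀ p q : Fin r, (s p).1 + j + ((s q).1 + j + 2) + 1 =
      (s p).1 + (s q).1 + 2 * (j + 1) + 1 := by
    intro p q; ring
  have e21 : ∀ p q : Fin r, (s p).1 + j + 2 + ((s q).1 + j) + 1 =
      (s p).1 + (s q).1 + 2 * (j + 1) + 1 := by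
    intro p q; ring
  have e22 : ∀ p q : Fin r, (s p).1 + j + 2 + ((s q).1 + j + 2) + 1 =
      (s p).1 + (s q).1 + 2 * (j + 2) + 1 := by
    intro p q; ring
  simp only [e11, e12, e21, e22, mul_neg, neg_mul, neg_neg, sum_neg_distrib, sum_add_distrib] at h
  unfold heisRPShiftForm
  simp only [mul_neg, sum_neg_distrib]
  linarith

/-- **Torus reflection symmetry of the shifted Gram forms of a palindromic family**: if `σ` permutes the
sites with `i_{σ p} + i_p = m - 1`, `t_{σ p} = t_p` and `c_{σ p} c_{σ q} = c_p c_q`, then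
`Q(k - m - j) = Q(j)` for `m + j ≤ k` (`c(2k - a, b) = c(a, b)`, `heisRedCorr2_two_mul_sub`).
[cite: LeesTaggi2021, Thm 4 (proof)] [cite: KLS1988JSP, p. 1021] -/
theorem heisRPShiftForm_symm (k n : ℕ) [NeZero (2 * k)] {r : ℕ} (s : Fin r → ℕ × ℕ) (c : Fin r → ℝ)
    {m : ℕ} (σ : Equiv.Perm (Fin r)) (hσ1 : ∀ p, (s (σ p)).1 + (s p).1 + 1 = m)
    (hσ2 : ∀ p, (s (σ p)).2 = (s p).2) (hσc : ∀ p q, c (σ p) * c (σ q) = c p * c q)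
    {j : ℕ} (hj : m + j ≤ k) :
    heisRPShiftForm k n s c (k - m - j) = heisRPShiftForm k n s c j := by
  unfold heisRPShiftForm
  rw [← Equiv.sum_comp σ]
  refine sum_congr rfl fun p _ => ?_
  rw [← Equiv.sum_comp σ]
  refine sum_congr rfl fun q _ => ?_
  have hp := hσ1 p; have hq := hσ1 q
  have ha0 : 0 < (s p).1 + (s q).1 + 2 * j + 1 := by omega
  have ha : (s p).1 + (s q).1 + 2 * j + 1 < 2 * k := by omega
  have e : (s (σ p)).1 + (s (σ q)).1 + 2 * (k - m - j) + 1 =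
      2 * k - ((s p).1 + (s q).1 + 2 * j + 1) := by
    omega
  rw [hσc p q, hσ2 p, hσ2 q, e, heisRedCorr2_two_mul_sub k n ha0 ha]

/-- From midpoint convexity and a reflection symmetry to monotonicity (the contradiction chain of
[LeesTaggi2021, proof of Thm 1, §4]): a real sequence `f` on `0, …, J`, `J ≥ 1`, with
non-decreasing increments and `f J = f 0` has `f 1 ≤ f 0`. [folklore] -/
private theorem shift_step_le_of_convex_of_symm (f : ℕ → ℝ) {J : ℕ} (hJ : 1 ≤ J)
    (hconv : ∀ j, j + 2 ≤ J → f (j + 1) - f j ≤ f (j + 2) - f (j + 1)) (hsym : f J = f 0) :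
    f 1 ≤ f 0 := by
  by_contra hlt'
  have hlt : f 0 < f 1 := not_le.mp hlt'
  have hmono : ∀ j, j + 1 ≤ J → f 1 - f 0 ≤ f (j + 1) - f j := by
    intro j
    induction j with
    | zero => intro _; exact le_rfl
    | succ j ih =>
      intro hj
      have h1 := ih (by omega)
      have h2 := hconv j (by omega)
      linarith
  have hsum : (J : ℝ) * (f 1 - f 0) ≤ ∑ j ∈ range J, (f (j + 1) - f j) :=
    calc (J : ℝ) * (f 1 - f 0) = ∑ j ∈ range J, (f 1 - f 0) := by
          rw [sum_const, card_range, nsmul_eq_mul]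
      _ ≤ ∑ j ∈ range J, (f (j + 1) - f j) :=
          sum_le_sum fun j hj => hmono j (by have := mem_range.1 hj; omega)
  rw [sum_range_sub, hsym, sub_self] at hsum
  have hJ' : (1 : ℝ) ≤ J := by exact_mod_cast hJ
  nlinarith

/-- **Shift monotonicity of reflection-positivity Gram forms for palindromic site families**
([LeesTaggi2021, Thm 4] with a general finitely supported test function): on the torus of side `2k`,
for a site family `s p = (i_p, t_p)` with weights `c_p` that is palindromic of depth `m`
(a permutation `σ` of the sites with `i_{σ p} + i_p = m - 1`, `t_{σ p} = t_p`, `c_{σ p} c_{σ q} = c_p c_q`)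
and `m + 2j + 1 ≤ k`:  `Q(j+1) ≤ Q(j)`, where `Q(j) = Σ_{p,q} c_p c_q (−c(i_p + i_q + 2j + 1, |t_p − t_q|))`
(`heisRPShiftForm`).  Special cases: the one-site family over two transverse offsets
(`heisRedCorr2_oddAxis_antitone`, `m = 1`) and the axis pair `(δ_j − δ_{j+1})` (`m = 2`).
In the spectral reading these are the `(1 − λ²)`-localising rows `∫ λ^{2j}(1 − λ²)|ĉ|² dμ ≥ 0`.
[cite: LeesTaggi2021, Thm 4, Lemma 7] [cite: KLS1988JSP, eq. (25)] -/
theorem heisRPShiftForm_antitone (k n : ℕ) [NeZero (2 * k)] {r : ℕ} (s : Fin r → ℕ × ℕ)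
    (c : Fin r → ℝ) {m : ℕ} (σ : Equiv.Perm (Fin r)) (hσ1 : ∀ p, (s (σ p)).1 + (s p).1 + 1 = m)
    (hσ2 : ∀ p, (s (σ p)).2 = (s p).2) (hσc : ∀ p q, c (σ p) * c (σ q) = c p * c q)
    (j : ℕ) (hk : m + 2 * j + 1 ≤ k) :
    heisRPShiftForm k n s c (j + 1) ≤ heisRPShiftForm k n s c j := by
  -- the sequence `i ↦ Q(j + i)` on `0, …, J` with `J = k - m - 2j`: convex, and `Q(j + J) = Q(k - m - j) = Q(j)`
  set f : ℕ → ℝ := fun i => heisRPShiftForm k n s c (j + i) with hf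
  have hrow : ∀ p, (s p).1 + 1 ≤ m := fun p => by have := hσ1 p; omega
  have hJ : 1 ≤ k - m - 2 * j := by omega
  have hconv : ∀ i, i + 2 ≤ k - m - 2 * j → f (i + 1) - f i ≤ f (i + 2) - f (i + 1) := by
    intro i hi
    have hc := heisRPShiftForm_midpointConvex k n s c (j + i)
      (fun p => by have := hrow p; omega)
    simp only [hf]
    have e1 : j + (i + 1) = j + i + 1 := by ring
    have e2 : j + (i + 2) = j + i + 2 := by ring
    rw [e1, e2]
    linarith
  have hsym : f (k - m - 2 * j) = f 0 := by
    simp only [hf, Nat.add_zero]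
    have e : j + (k - m - 2 * j) = k - m - j := by omega
    rw [e]
    exact heisRPShiftForm_symm k n s c σ hσ1 hσ2 hσc (by omega)
  have h := shift_step_le_of_convex_of_symm f hJ hconv hsym
  simpa [hf] using h

/-- Usage check, the **one-site, one-offset** instance (`m = 1`, one site `(0,0)`, weight `1`):
for `2j + 2 ≤ k`, `−c(2j+3, 0) ≤ −c(2j+1, 0)`.
[cite: LeesTaggi2021, Thm 4] -/
theorem heisRedCorr2_oddAxis_antitone_oneSite (k n : ℕ) [NeZero (2 * k)] (j : ℕ) (hk : 2 * j + 2 ≤ k) :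
    -heisRedCorr2 (2 * k) n (2 * j + 3) 0 ≤ -heisRedCorr2 (2 * k) n (2 * j + 1) 0 := by
  have h := heisRPShiftForm_antitone k n (r := 1) (fun _ => (0, 0)) (fun _ => (1 : ℝ)) (m := 1)
    (Equiv.refl _) (fun _ => by simp) (fun _ => by simp) (fun _ _ => by simp) j (by omega)
  unfold heisRPShiftForm at h
  have e1 : 2 * (j + 1) + 1 = 2 * j + 3 := by ring
  simp only [univ_unique, Fin.default_eq_zero, sum_singleton, one_mul, zero_add, sub_self,
    Int.natAbs_zero, Nat.cast_zero, e1] at h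
  exact h

end Literature.MathematicalPhysics.QuantumLattice

end
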